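import Mathlib

/-!
# Maximal-volume pivot blocks are dominant

The algebraic core of the *maximum-volume principle* for cross (CUR / skeleton) interpolation
and of the `maxvol` pivoting heuristics: the interpolation coefficients of a cross
interpolation are ratios of determinants, so a pivot block of locally maximal volume
(`|det|`) makes all of them at most `1` in modulus.

For a matrix `A : Matrix m ι K` ("tall": its columns are already the pivot columns) and pivot
rows `r : ι → m` with pivot block `P = A.submatrix r id`:

* `mul_inv_submatrix_apply_mul_det` — CRAMER FORM of the coefficients:
  `(A P⁻¹) i j · det P = det (A.submatrix (update r j i) id)`, the determinant of `P` with its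
  `j`-th row replaced by row `i` of `A` [HornJohnson2013, §0.8.3]; the transposed statement
  `inv_submatrix_mul_apply_mul_det` for pivot columns (`(P⁻¹ A) i j · det P`);
* `abs_mul_inv_submatrix_le_one_of_volume_maximal` — MAXIMAL VOLUME ⇒ DOMINANT: if `|det P|`
  is maximal among the pivot-row choices differing from `r` in at most one position (a
  fortiori if it is maximal among all `#ι`-row choices), then every entry of `A P⁻¹` has
  modulus `≤ 1`, i.e. `P` is *dominant* [AllenLaiShen2024, Definition 1 and Lemma 1] (after
  Goreinov–Oseledets–Savostyanov–Tyrtyshnikov–Zamarashkin, *How to find a good submatrix*);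
  `abs_inv_submatrix_mul_le_one_of_volume_maximal` is the pivot-column version.

In the cross-interpolation notation of `Literature.LinearAlgebra.Matrix.crossInterp`
(`Ã = C P⁻¹ R`), these are the factors `C P⁻¹` and `P⁻¹ R`.  Not formalised: the
singular-value error bounds (`‖A - Ã‖ ≤ (r+1) σᵣ₊₁`, `(r+1)²`-type Chebyshev bounds), the
`r^{r/2}` volume comparison of dominant vs. maximal-volume blocks, or any search algorithm.

References: R. A. Horn, C. R. Johnson, *Matrix Analysis*, 2nd ed., CUP 2013, §0.8.3
(Cramer's rule); K. Allen, M.-J. Lai, Z. Shen, *Maximal volume matrix cross approximation for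
image compression and least squares solution*, Adv. Comput. Math. (2024), arXiv:2309.17403,
§2 Definition 1, Lemma 1.
AI-produced formalisation (H21 engines group, seat eng-quad-2, 2026-08-21); no facts, no axioms
beyond Mathlib's, no `sorry`.
-/

open Matrix

namespace Literature.LinearAlgebra.Matrix

section CommRing

variable {K : Type*} [CommRing K]
variable {m n ι : Type*} [Fintype ι] [DecidableEq ι]

/-- [cite: HornJohnson2013, §0.8.3] CRAMER FORM OF THE ROW-INTERPOLATION COEFFICIENTS: with
pivot rows `r` and nonsingular pivot block `P = A.submatrix r id`, the coefficient
`(A P⁻¹) i j` times `det P` is the determinant of `P` with its `j`-th row replaced by the `i`-th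
row of `A`, i.e. of the pivot block of the row choice `update r j i`. -/
theorem mul_inv_submatrix_apply_mul_det (A : Matrix m ι K) (r : ι → m)
    (hP : IsUnit (A.submatrix r id).det) (i : m) (j : ι) :
    (A * (A.submatrix r id)⁻¹) i j * (A.submatrix r id).det =
      (A.submatrix (Function.update r j i) id).det := by
  set P : Matrix ι ι K := A.submatrix r id with hPdef
  have h1 : (P.det • (A i ᵥ* P⁻¹)) j = (A * P⁻¹) i j * P.det := by
    simp only [Pi.smul_apply, smul_eq_mul, vecMul, dotProduct, mul_apply]
    ring
  have h2 : P.det • (A i ᵥ* P⁻¹) = cramer Pᵀ (A i) :=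
    det_smul_inv_vecMul_eq_cramer_transpose P (A i) hP
  rw [← h1, h2, cramer_apply, updateCol_transpose, det_transpose]
  congr 1
  ext k l
  simp only [updateRow_apply, hPdef, submatrix_apply, id_eq, Function.update_apply]
  split_ifs <;> rfl

/-- [cite: HornJohnson2013, §0.8.3] CRAMER FORM OF THE COLUMN-INTERPOLATION COEFFICIENTS: with
pivot columns `c` and nonsingular pivot block `P = A.submatrix id c`,
`(P⁻¹ A) i j · det P = det (A.submatrix id (update c i j))` (the pivot block with its `i`-th
column replaced by the `j`-th column of `A`). -/
theorem inv_submatrix_mul_apply_mul_det (A : Matrix ι n K) (c : ι → n)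
    (hP : IsUnit (A.submatrix id c).det) (i : ι) (j : n) :
    ((A.submatrix id c)⁻¹ * A) i j * (A.submatrix id c).det =
      (A.submatrix id (Function.update c i j)).det := by
  have hPt : IsUnit (Aᵀ.submatrix c id).det := by
    rwa [← transpose_submatrix, det_transpose]
  have h := mul_inv_submatrix_apply_mul_det Aᵀ c hPt j i
  rwa [← transpose_submatrix, ← transpose_submatrix, det_transpose, det_transpose,
    ← transpose_nonsing_inv, ← transpose_mul, transpose_apply] at h

end CommRing

section Ordered

variable {K : Type*} [CommRing K] [LinearOrder K] [IsStrictOrderedRing K]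
variable {m n ι : Type*} [Fintype ι] [DecidableEq ι]

/-- [cite: AllenLaiShen2024, Lemma 1]; [cite: AllenLaiShen2024, Definition 1]
MAXIMAL VOLUME ⇒ DOMINANT (pivot rows): if the pivot block `P = A.submatrix r id` is
nonsingular and `|det P|` is maximal among the pivot-row choices obtained from `r` by changing
one position, then every row-interpolation coefficient satisfies `|(A P⁻¹) i j| ≤ 1` — `P` is a
*dominant* submatrix. -/
theorem abs_mul_inv_submatrix_le_one_of_volume_maximal (A : Matrix m ι K) (r : ι → m)
    (hP : IsUnit (A.submatrix r id).det)
    (hmax : ∀ i j, |(A.submatrix (Function.update r j i) id).det| ≤ |(A.submatrix r id).det|)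
    (i : m) (j : ι) : |(A * (A.submatrix r id)⁻¹) i j| ≤ 1 := by
  have hdet : 0 < |(A.submatrix r id).det| := abs_pos.mpr hP.ne_zero
  have key : |(A * (A.submatrix r id)⁻¹) i j| * |(A.submatrix r id).det| ≤
      1 * |(A.submatrix r id).det| := by
    rw [← abs_mul, mul_inv_submatrix_apply_mul_det A r hP i j, one_mul]
    exact hmax i j
  exact le_of_mul_le_mul_right key hdet

/-- [cite: AllenLaiShen2024, Lemma 1]; [cite: AllenLaiShen2024, Definition 1]
MAXIMAL VOLUME ⇒ DOMINANT (pivot columns): if `P = A.submatrix id c` is nonsingular and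
`|det P|` is maximal among the pivot-column choices obtained from `c` by changing one position,
then `|(P⁻¹ A) i j| ≤ 1` for all `i, j`. -/
theorem abs_inv_submatrix_mul_le_one_of_volume_maximal (A : Matrix ι n K) (c : ι → n)
    (hP : IsUnit (A.submatrix id c).det)
    (hmax : ∀ i j, |(A.submatrix id (Function.update c i j)).det| ≤ |(A.submatrix id c).det|)
    (i : ι) (j : n) : |((A.submatrix id c)⁻¹ * A) i j| ≤ 1 := by
  have hdet : 0 < |(A.submatrix id c).det| := abs_pos.mpr hP.ne_zero
  have key : |((A.submatrix id c)⁻¹ * A) i j| * |(A.submatrix id c).det| ≤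
      1 * |(A.submatrix id c).det| := by
    rw [← abs_mul, inv_submatrix_mul_apply_mul_det A c hP i j, one_mul]
    exact hmax i j
  exact le_of_mul_le_mul_right key hdet

end Ordered

end Literature.LinearAlgebra.Matrix
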